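import Summits.NavierStokesRegularity.NavierStokesRegularity.Theses.HodographBetchov
import Literature.Analysis.FluidPDE.WholeSpaceIBPIntegrable
import Literature.Analysis.FluidPDE.LerayGaugeStrainSpectrum
import Literature.Analysis.Calculus.JacobianNullLagrangian
import Mathlib.Analysis.InnerProductSpace.Laplacian

/-!
# Sketch — crux-ideate round 1, ideator 2, crux `HodographBetchov.ClassBudgetsRegularise`
(stmt-NavierStokesRegularity-16863)

First-lemma signatures of the three crux idea cards of this seat (they need not be proved; they
must elaborate).  One of them, the algebraic certificate behind card 2, IS proved below
(`millerCertificate_holds`), as the card's cheapest falsifier run in Lean.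

* card `bounded-velocity-primitive` : `speedPrimitive`, `SpeedPrimitiveBound`,
  `SlowBallJacobianVanishes`, `SlowClassBetchov`;
* card `shear-instantiated-miller` : `MillerCertificate` (PROVED), `PlaneMajorantMiller`,
  `EffectiveMajorantDominates`;
* card `apriori-slot-restart` : `ClassLedgerSlice`, `UniformLedgerExtends`.
-/

noncomputable section

open MeasureTheory Set Filter Topology Function
open scoped ENNReal NNReal InnerProductSpace RealInnerProductSpace Laplacian
open Literature.Analysis.FluidPDE

namespace Summit.NavierStokesRegularity.NavierStokesRegularity.Cruxes.ClassBudgetsRegularise.Ideator2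

local notation "ℝ³" => EuclideanSpace ℝ (Fin 3)

/-! ## Card 1 — bounded velocity-space primitive (degree-free, decay-free class identities) -/

/-- The velocity-space primitive of a speed profile `h : ℝ → ℝ`:
`B_h(v) = β(‖v‖) v` with `β(r) = r⁻³ ∫₀ʳ h(s) s² ds`, so that `div_v B_h = h ∘ ‖·‖`
(`(r³β)' = h r²`).  For `0 ≤ h ≤ 1` supported in `[0, L]` it is BOUNDED by `L/3`. -/
def speedPrimitive (h : ℝ → ℝ) (v : ℝ³) : ℝ³ :=
  ((∫ s in (0 : ℝ)..‖v‖, h s * s ^ 2) / ‖v‖ ^ 3) • v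

/-- `‖B_h(v)‖ ≤ L/3` for every profile `0 ≤ h ≤ 1` vanishing on `[L, ∞)` (elementary:
`∫₀ʳ h s² ≤ min(r, L)³/3`). -/
def SpeedPrimitiveBound : Prop :=
  ∀ (h : ℝ → ℝ) (L : ℝ), 0 < L → (∀ s, 0 ≤ h s ∧ h s ≤ 1) → (∀ s, L ≤ s → h s = 0) →
    ∀ v : ℝ³, ‖speedPrimitive h v‖ ≤ L / 3

/-- `div_v B_h = h(‖v‖)` away from the origin, for continuous profiles (and at the origin too when
`h` is constant near `0`). -/
def SpeedPrimitiveDivergence : Prop :=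
  ∀ (h : ℝ → ℝ), Continuous h → ∀ v : ℝ³, v ≠ 0 →
    VectorCalculus.divergence (speedPrimitive h) v = h ‖v‖

/-- **First lemma of card 1 (slow-ball Jacobian identity, decay-free).**  For `u ∈ C²(ℝ³; ℝ³)`
with `∇u ∈ L² ∩ L³` (no decay of `u` itself, no divergence condition, no degree theory) and every
speed level `l > 0`: `∫_{‖u‖ ≤ l} det ∇u dx = 0`.  Proof route: Piola pull-back identity
`div (adj(∇u) · B_h(u)) = h(‖u‖) det ∇u` (tree: `Literature.Analysis.Calculus.sum_fderiv_piolaField`)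
with the bounded primitive `B_h`, the `L¹` divergence theorem on the whole space (tree:
`integral_divergence_eq_zero_of_integrable`, flux `≤ (L/3)|∇u|² ∈ L¹`, divergence `≤ |∇u|³ ∈ L¹`),
then `h ↓ 1_{[0,l]}` by dominated convergence. -/
def SlowBallJacobianVanishes : Prop :=
  ∀ (u : ℝ³ → ℝ³), ContDiff ℝ 2 u →
    Integrable (fun x => ‖fderiv ℝ u x‖ ^ 2) → Integrable (fun x => ‖fderiv ℝ u x‖ ^ 3) →
    ∀ l : ℝ, 0 < l → ∫ x in {x | ‖u x‖ ≤ l}, (fderiv ℝ u x).det = 0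

/-- **Slow-class Betchov, decay-free** (card 1, the form the enstrophy ledger consumes): for a
divergence-free `u` as above, `∫_{‖u‖≤l} ω·(∇u)ω = −4 ∫_{‖u‖≤l} det S`, `S = ½(∇u + ∇uᵀ)`
(pointwise `det ∇u = det S + ¼ ω·Sω` for trace-free gradients, then `SlowBallJacobianVanishes`). -/
def SlowClassBetchov : Prop :=
  ∀ (u : ℝ³ → ℝ³), ContDiff ℝ 2 u →
    Integrable (fun x => ‖fderiv ℝ u x‖ ^ 2) → Integrable (fun x => ‖fderiv ℝ u x‖ ^ 3) →
    VectorCalculus.IsDivFree u → ∀ l : ℝ, 0 < l →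
      ∫ x in {x | ‖u x‖ ≤ l}, ⟪curl u x, fderiv ℝ u x (curl u x)⟫ =
        -4 * ∫ x in {x | ‖u x‖ ≤ l},
          (((1 / 2 : ℝ) • (fderiv ℝ u x + ContinuousLinearMap.adjoint (fderiv ℝ u x))).det)

/-! ## Card 2 — Miller's inequality by instantiating the plane clause at the off-plane shears -/

/-- **The algebraic certificate.**  In an orthonormal frame `(v, w, v × w)` write the (trace-free)
strain as `S = [[a, b, d], [b, c, e], [d, e, f]]`, `f = −(a + c)`.  If the quadratic form of `S` on
the plane `⟨v, w⟩` is `≤ m` (`m ≥ 0`), then `−det S ≤ ½ m |S|²_F`.  Proof (below): with `x = m − a`,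
`y = m − c`, `s = xy − b²`:  `½ m|S|² + det S = [(m−c)d² + 2bde + (m−a)e²] + [m³ − 3ms + (x+y)s]`;
the first bracket is the HYPOTHESIS at `(α, β) = (e, −d)`, the second is `≥ (m − √s)²(m + 2√s) ≥ 0`. -/
def MillerCertificate : Prop :=
  ∀ a b c d e m : ℝ, 0 ≤ m →
    (∀ α β : ℝ, a * α ^ 2 + 2 * b * α * β + c * β ^ 2 ≤ m * (α ^ 2 + β ^ 2)) →
    -(a * (c * (-(a + c)) - e ^ 2) - b * (b * (-(a + c)) - d * e) + d * (b * e - c * d)) ≤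
      m / 2 * (a ^ 2 + c ^ 2 + (a + c) ^ 2 + 2 * b ^ 2 + 2 * d ^ 2 + 2 * e ^ 2)

/-- The certificate holds (cheapest falsifier of card 2, run in Lean). -/
theorem millerCertificate_holds : MillerCertificate := by
  intro a b c d e m hm H
  -- (1) the clause at the off-plane shear pair `(α, β) = (e, -d)` is the `(d, e)`-block `Q ≥ 0`
  have hQ : a * e ^ 2 + 2 * b * e * (-d) + c * (-d) ^ 2 ≤ m * (e ^ 2 + (-d) ^ 2) := H e (-d)
  -- (2) its three scalar shadows `a ≤ m`, `c ≤ m`, `b² ≤ (m-a)(m-c)`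
  have ha : a ≤ m := by have := H 1 0; nlinarith
  have hc : c ≤ m := by have := H 0 1; nlinarith
  have hdisc : b ^ 2 ≤ (m - a) * (m - c) := by
    have h2 : ∀ t : ℝ, 0 ≤ (m - a) * (t * t) + (-2 * b) * t + (m - c) := by
      intro t; have := H t 1; nlinarith
    have hd := discrim_le_zero h2
    rw [discrim] at hd
    nlinarith
  -- (3) the remainder `R = m³ − 3ms + (x+y)s ≥ (m − √s)²(m + 2√s) ≥ 0`
  set x := m - a with hx
  set y := m - c with hy
  have hx0 : 0 ≤ x := by rw [hx]; linarith
  have hy0 : 0 ≤ y := by rw [hy]; linarith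
  set s := x * y - b ^ 2 with hs
  have hs0 : 0 ≤ s := by rw [hs]; linarith
  have hsxy : s ≤ ((x + y) / 2) ^ 2 := by rw [hs]; nlinarith [sq_nonneg b, sq_nonneg (x - y)]
  set t := Real.sqrt s with ht
  have ht0 : 0 ≤ t := Real.sqrt_nonneg _
  have ht2 : t ^ 2 = s := Real.sq_sqrt hs0
  have hxy : t ≤ (x + y) / 2 := by
    calc t = Real.sqrt s := rfl
      _ ≤ Real.sqrt (((x + y) / 2) ^ 2) := Real.sqrt_le_sqrt hsxy
      _ = (x + y) / 2 := Real.sqrt_sq (by linarith)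
  have hR : 0 ≤ m ^ 3 - 3 * m * s + (x + y) * s := by
    have h1 : 2 * t * s ≤ (x + y) * s := mul_le_mul_of_nonneg_right (by linarith) hs0
    have h2 : 0 ≤ (m - t) ^ 2 * (m + 2 * t) := mul_nonneg (sq_nonneg _) (by linarith)
    have key : m ^ 3 - 3 * m * s + (x + y) * s =
        (m - t) ^ 2 * (m + 2 * t) + ((x + y) * s - 2 * t * s) := by
      rw [← ht2]; ring
    rw [key]; linarith
  -- (4) `½ m |S|² + det S = Q + R`
  simp only [hs, hx, hy] at hR
  nlinarith [hQ, hR]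

/-- **First lemma of card 2 (plane-majorant Miller inequality, eigenvalue-free).**  For a trace-free
`A : ℝ³ →L ℝ³` (`A = ∇u(x)`, `div u = 0`) and `m ≥ 0` majorising the quadratic form of `A` on some
plane (the crux's Courant–Fischer clause verbatim): `−det(½(A + A†)) ≤ (3/2) m ‖A‖²`
(`½ m|S|²_F ≤ ½ m|A|²_F ≤ (3/2) m ‖A‖²_op`).  From `MillerCertificate` after completing `(v, w)` to the
orthonormal frame `(v, w, v × w)`. -/
def PlaneMajorantMiller : Prop :=
  ∀ (A : ℝ³ →L[ℝ] ℝ³), LinearMap.trace ℝ ℝ³ (A : ℝ³ →ₗ[ℝ] ℝ³) = 0 →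
    ∀ m : ℝ, 0 ≤ m →
      (∃ v w : ℝ³, ‖v‖ = 1 ∧ ‖w‖ = 1 ∧ ⟪v, w⟫ = 0 ∧
        ∀ α β : ℝ, ⟪A (α • v + β • w), α • v + β • w⟫ ≤ m * (α ^ 2 + β ^ 2)) →
      -(((1 / 2 : ℝ) • (A + ContinuousLinearMap.adjoint A)).det) ≤ 3 / 2 * m * ‖A‖ ^ 2

/-- **The effective majorant** (card 2, measurability without eigenvalues or selections): the
explicit, continuous-in-`A` quantity `g(A) = (−2 det S)⁺ / |A|²_F` (junk `0` at `A = 0`) satisfies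
`−det S ≤ ½ g |A|²_F` tautologically and `g ≤ m` whenever the plane clause holds at level `m ≥ 0`
(by `PlaneMajorantMiller` in Frobenius form); so Hölder is run with `g ∘ ∇u` (measurable) and the
possibly non-measurable hypothesis majorant `m` enters only through monotonicity of `∫⁻`. -/
def EffectiveMajorantDominates : Prop :=
  ∀ (A : ℝ³ →L[ℝ] ℝ³), LinearMap.trace ℝ ℝ³ (A : ℝ³ →ₗ[ℝ] ℝ³) = 0 →
    ∀ m : ℝ, 0 ≤ m →
      (∃ v w : ℝ³, ‖v‖ = 1 ∧ ‖w‖ = 1 ∧ ⟪v, w⟫ = 0 ∧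
        ∀ α β : ℝ, ⟪A (α • v + β • w), α • v + β • w⟫ ≤ m * (α ^ 2 + β ^ 2)) →
      max 0 (-(2 : ℝ) * (((1 / 2 : ℝ) • (A + ContinuousLinearMap.adjoint A)).det)) ≤
        m * frobeniusNormSq A

/-! ## Card 3 — the a-priori slot of the restart induction: the class ledger at ONE time slice -/

/-- **First lemma of card 3 (the class-budget ledger at a fixed time).**  Let `v, W : ℝ³ → ℝ³`,
`q : ℝ³ → ℝ` satisfy the momentum equation `W + (v·∇)v = νΔv − ∇q` with `div v = div W = 0`
(`v = u(t)`, `W = ∂ₜu(t)`, `q = p(t)` of a strong slice; the hypothesis list copies the tree's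
`integral_sum_inner_fderiv_le_of_momentum`, with `|v| ≤ M` replaced by `∇v ∈ L³`).  Then for every
level `l > 0` and every measurable `g ≥ 0` majorising the plane clause of `∇v` on the fast class
`{l < ‖v‖}` with `g |∇v|² ∈ L¹` there:
`Σᵢ ∫⟪∂ᵢv, ∂ᵢW⟫ ≤ −ν ∫‖D²v‖² + ∫_{‖v‖≤l} ω·(∇v)ω + 2 ∫_{l<‖v‖} g |∇v|²_F`
(`Σᵢ∫⟪∂ᵢv,∂ᵢW⟫ = −ν|D²v|² − ∫ A²:A`, `A²:A = 4 det S − det A` for trace-free `A`, slow class by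
`SlowClassBetchov`, fast class by the Jacobian class identity + `PlaneMajorantMiller`). -/
def ClassLedgerSlice : Prop :=
  ∀ (ν : ℝ), 0 < ν → ∀ (v W : ℝ³ → ℝ³) (q : ℝ³ → ℝ),
    ContDiff ℝ 3 v → ContDiff ℝ 1 W → ContDiff ℝ 1 q →
    (∀ x, W x + convect v v x = ν • (Δ v) x - gradient q x) →
    VectorCalculus.IsDivFree v → VectorCalculus.IsDivFree W →
    (∫⁻ x, ‖v x‖ₑ ^ 2 < ⊤) → Integrable (fun x => ‖fderiv ℝ v x‖ ^ 2) →
    Integrable (fun x => ‖fderiv ℝ v x‖ ^ 3) → (∫⁻ x, ‖iteratedFDeriv ℝ 2 v x‖ₑ ^ 2 < ⊤) →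
    (∫⁻ x, ‖W x‖ₑ ^ 2 < ⊤) → (∫⁻ x, ‖iteratedFDeriv ℝ 1 W x‖ₑ ^ 2 < ⊤) →
    (∫⁻ x, ‖q x‖ₑ ^ 2 < ⊤) → (∫⁻ x, ‖iteratedFDeriv ℝ 1 q x‖ₑ ^ 2 < ⊤) →
    ∀ l : ℝ, 0 < l → ∀ g : ℝ³ → ℝ, Measurable g → (∀ x, 0 ≤ g x) →
      (∀ x, l < ‖v x‖ → ∃ a b : ℝ³, ‖a‖ = 1 ∧ ‖b‖ = 1 ∧ ⟪a, b⟫ = 0 ∧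
        ∀ α β : ℝ, ⟪fderiv ℝ v x (α • a + β • b), α • a + β • b⟫ ≤ g x * (α ^ 2 + β ^ 2)) →
      IntegrableOn (fun x => g x * frobeniusNormSq (fderiv ℝ v x)) {x | l < ‖v x‖} →
      ∫ x, ∑ i, ⟪fderiv ℝ v x (EuclideanSpace.basisFun (Fin 3) ℝ i),
          fderiv ℝ W x (EuclideanSpace.basisFun (Fin 3) ℝ i)⟫ ≤
        -ν * (∫ x, ‖iteratedFDeriv ℝ 2 v x‖ ^ 2) +
          (∫ x in {x | ‖v x‖ ≤ l}, ⟪curl v x, fderiv ℝ v x (curl v x)⟫) +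
          2 * ∫ x in {x | l < ‖v x‖}, g x * frobeniusNormSq (fderiv ℝ v x)

/-- **The a-priori slot** (card 3, the transfer target `C⁺`): a classical Leray–Hopf solution on
`[0, T)` from a rapidly decaying datum whose enstrophy obeys ONE bound `E` on every closed initial
slab `[0, s]`, `s < T`, on which it is `H¹`-bounded, extends smoothly past `T`.  This is the shape in
which the tree's restart induction (`h1Bounded_restart`, `isH1RegularOn_restart`, with
`leray_local_strong_H1_holds`) consumes an a-priori estimate; the class-budget Grönwall
(`ClassLedgerSlice` integrated in time + the two budgets) supplies exactly such an `E`. -/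
def UniformLedgerExtends : Prop :=
  ∀ (ν T : ℝ), 0 < ν → 0 < T → ∀ (u : ℝ → ℝ³ → ℝ³) (p : ℝ → ℝ³ → ℝ),
    IsClassicalNSSolutionOn (Set.Ico 0 T) ν 0 u p → IsLerayHopfOn T ν 0 (u 0) u →
    HasRapidSpatialDecay (u 0) →
    (∃ E : ℝ≥0, ∀ s ∈ Set.Ico 0 T,
      (∃ C₁ : ℝ≥0, ∀ t ∈ Set.Icc 0 s, ∫⁻ x, ‖iteratedFDeriv ℝ 1 (u t) x‖ₑ ^ 2 ≤ C₁) →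
      ∀ t ∈ Set.Icc 0 s, ∫⁻ x, ‖iteratedFDeriv ℝ 1 (u t) x‖ₑ ^ 2 ≤ E) →
    HasSmoothExtensionPast ν 0 u T

end Summit.NavierStokesRegularity.NavierStokesRegularity.Cruxes.ClassBudgetsRegularise.Ideator2

end
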